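import Mathlib
import Summits.Schanuel.Schanuel.Theses.RigidCore
import Literature.NumberTheory.Transcendental.ZilberFieldExistenceProofs
import Literature.NumberTheory.Transcendental.SchanuelEclEmptyProofs

/-!
# stub-proved: `stub_endgame` (line kernel-arithmetic-selection, skeleton f7f45f09face) — readable copy for the lead

Support for the line `kernel-arithmetic-selection` (skeleton f7f45f09face), landed by the crux disprover
(`--supports`): the registered stub `stub_endgame` is PROVED verbatim (`stub_endgame_holds`), at every
rank and from `SchanuelRank m` (`m < n`) alone — no Baker, no Ax.  If `x` is a first failure of rank
`n`, `m < n`, `q` are `m` independent rational forms and the affine space `{z | q z = q x}` lies in the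
frozen fibre `{z | ∀ p ∈ rel x, p(z, eˣ) = 0}`, then:
* `exists_kernel_frame` — rational `d₁..d_r` (`r = n − m`) killed by `q` with rational duals `c_k`;
* `spreadMap` `ψ : ℚ[X,Y] → ℂ[T₁..T_r]`, `X ↦ x + Σ T_k d_k`, `Y ↦ eˣ`; `eval_spreadMap`; every relation of
  `(x, eˣ)` dies under `ψ` (the fibre hypothesis + `MvPolynomial.funext`); `spreadMap_linearForm`;
* `algebraicIndependent_shift_constants` — shifted variables `C a_k + T_k` plus algebraically
  independent constants are algebraically independent (shift back, separate variables
  `MvPolynomial.sumRingEquiv`, `map_injective`);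
* `stub_endgame_holds` — `y := q x` is an LI `m`-tuple whose exponentials are algebraic over `ℚ(eˣ)`
  (`exp_mem_adjoin_exp_of_mem_span_int`, `mem_acl_of_pow_mem`), so `SchanuelRank m` yields `m`
  algebraically independent elements among `q x ∪ eˣ`; with the `r` shifted variables they pull back
  along `ψ` to `n = r + m` algebraically independent elements of `ℚ(x, eˣ)` — against `trdeg < n`.

## References

* J. Kirby, *Exponential algebraicity in exponential fields*, Bull. LMS 42 (2010), arXiv:0810.4285, §1.
* Crux work file `Cruxes/MinimalCounterexampleInAcl/CDISPROVE-stub_endgame-plan.md` (the plan).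
-/

noncomputable section

set_option linter.dupNamespace false

open Complex Set
open Literature.NumberTheory.Transcendental

namespace Summit.Schanuel.Schanuel.Cruxes.MinimalCounterexampleInAcl.StubsEvidence6

/-- For `m` ℚ-linearly independent rational forms `q` on `ℚⁿ` there are `r = n − m` rational vectors
`d_k` killed by every `q_j` together with rational "dual" vectors `c_k` (`c_k · d_{k'} = δ_{kk'}`).
[folklore] -/
theorem exists_kernel_frame {n m : ℕ} (q : Fin m → Fin n → ℚ) (hq : LinearIndependent ℚ q) :
    ∃ (r : ℕ) (d c : Fin r → Fin n → ℚ), r + m = n ∧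
      (∀ j k, ∑ i, q j i * d k i = 0) ∧ (∀ k k', ∑ i, c k i * d k' i = if k = k' then 1 else 0) := by
  classical
  let Q : (Fin n → ℚ) →ₗ[ℚ] (Fin m → ℚ) := Matrix.mulVecLin (q : Matrix (Fin m) (Fin n) ℚ)
  have hQ : ∀ z j, Q z j = ∑ i, q j i * z i := fun z j => by
    simp [Q, Matrix.mulVec, dotProduct]
  have hrank : Module.finrank ℚ (LinearMap.range Q) = m := by
    have h := LinearIndependent.rank_matrix (M := (q : Matrix (Fin m) (Fin n) ℚ)) hq
    simpa [Matrix.rank] using h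
  have hker : Module.finrank ℚ (LinearMap.ker Q) + m = n := by
    have h := LinearMap.finrank_range_add_finrank_ker Q
    rw [hrank, Module.finrank_fin_fun] at h
    omega
  set r := Module.finrank ℚ (LinearMap.ker Q) with hr
  let b := Module.finBasis ℚ (LinearMap.ker Q)
  let d : Fin r → Fin n → ℚ := fun k => (LinearMap.ker Q).subtype (b k)
  have hd_ker : ∀ k, Q (d k) = 0 := fun k => (b k).2
  have hdli : LinearIndependent ℚ d :=
    b.linearIndependent.map' (LinearMap.ker Q).subtype (Submodule.ker_subtype _)
  let D : (Fin r → ℚ) →ₗ[ℚ] (Fin n → ℚ) := Fintype.linearCombination ℚ d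
  have hD : ∀ t, D t = ∑ k, t k • d k := fun t => Fintype.linearCombination_apply ℚ d t
  have hDker : LinearMap.ker D = ⊥ := by
    rw [LinearMap.ker_eq_bot']
    intro t ht
    rw [hD] at ht
    exact funext ((Fintype.linearIndependent_iff.1 hdli) t ht)
  obtain ⟨π, hπ⟩ := LinearMap.exists_leftInverse_of_injective D hDker
  have hπD : ∀ t, π (D t) = t := fun t => by
    have := LinearMap.congr_fun hπ t
    simpa using this
  let c : Fin r → Fin n → ℚ := fun k i => π (Pi.single i 1) k
  refine ⟨r, d, c, hker, fun j k => ?_, fun k k' => ?_⟩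
  · have h := congrFun (hd_ker k) j
    rw [hQ] at h
    simpa using h
  · -- `Σ_i c k i * d k' i = (π (d k')) k = (π (D e_{k'})) k = e_{k'} k`
    have h1 : ∑ i, c k i * d k' i = (π (d k')) k := by
      have hsum : π (d k') = ∑ i, d k' i • π (Pi.single i 1) := by
        conv_lhs => rw [pi_eq_sum_univ' (d k')]
        rw [map_sum]
        refine Finset.sum_congr rfl fun i _ => ?_
        rw [map_smul]
      rw [hsum, Finset.sum_apply]
      refine Finset.sum_congr rfl fun i _ => ?_
      simp [c, mul_comm]
    have h2 : d k' = D (Pi.single k' 1) := by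
      rw [hD]
      rw [Finset.sum_eq_single k']
      · simp
      · intro k'' _ hne
        simp [hne]
      · intro h; exact absurd (Finset.mem_univ _) h
    rw [h1, h2, hπD]
    simp [Pi.single_apply]

/-! ### The spreading map `ψ : ℚ[X,Y] → ℂ[T]` -/

section Spread

variable {n r : ℕ} (x : Fin n → ℂ) (d : Fin r → Fin n → ℚ)

/-- The spreading map `ψ : ℚ[X,Y] → ℂ[T₁,…,T_r]`, `X_i ↦ x_i + Σ_k d_{k,i} T_k`, `Y_i ↦ e^{x_i}`. -/
def spreadMap : MvPolynomial (Fin n ⊕ Fin n) ℚ →ₐ[ℚ] MvPolynomial (Fin r) ℂ :=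
  MvPolynomial.aeval
    (Sum.elim (fun i => MvPolynomial.C (x i) + ∑ k, MvPolynomial.C (((d k i : ℚ) : ℂ)) * MvPolynomial.X k)
      (fun i => MvPolynomial.C (cexp (x i))))

/-- Evaluating `ψ p` at `t ∈ ℂ^r` is evaluating `p` at the point `(x + Σ t_k d_k, eˣ)`. [folklore] -/
theorem eval_spreadMap (t : Fin r → ℂ) (p : MvPolynomial (Fin n ⊕ Fin n) ℚ) :
    MvPolynomial.eval t (spreadMap x d p) =
      MvPolynomial.aeval (Sum.elim (fun i => x i + ∑ k, (((d k i : ℚ) : ℂ)) * t k) (cexp ∘ x)) p := by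
  have key : ((MvPolynomial.aeval t : MvPolynomial (Fin r) ℂ →ₐ[ℂ] ℂ).restrictScalars ℚ).comp
      (spreadMap x d) =
      MvPolynomial.aeval (Sum.elim (fun i => x i + ∑ k, (((d k i : ℚ) : ℂ)) * t k) (cexp ∘ x)) := by
    refine MvPolynomial.algHom_ext fun s => ?_
    rcases s with i | i
    · simp [spreadMap, mul_comm]
    · simp [spreadMap]
  have h := congrArg (fun f => f p) key
  simpa [MvPolynomial.coe_aeval_eq_eval] using h

/-- `ψ` of a rational linear form `Σ a_i X_i`. [folklore] -/
theorem spreadMap_linearForm (a : Fin n → ℚ) :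
    spreadMap x d (∑ i, MvPolynomial.C (a i) * MvPolynomial.X (Sum.inl i)) =
      MvPolynomial.C (∑ i, ((a i : ℚ) : ℂ) * x i) +
        ∑ k, MvPolynomial.C (((∑ i, a i * d k i : ℚ) : ℂ)) * MvPolynomial.X k := by
  apply MvPolynomial.funext
  intro t
  rw [eval_spreadMap]
  simp only [map_sum, map_mul, map_add, MvPolynomial.aeval_C, MvPolynomial.aeval_X, Sum.elim_inl,
    MvPolynomial.eval_C, MvPolynomial.eval_X, eq_ratCast, Rat.cast_sum, Rat.cast_mul]
  simp only [mul_add, Finset.sum_add_distrib, Finset.mul_sum, Finset.sum_mul]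
  congr 1
  rw [Finset.sum_comm]
  refine Finset.sum_congr rfl fun k _ => Finset.sum_congr rfl fun i _ => ?_
  ring

/-- `ψ (Y_i) = C (e^{x_i})`. [folklore] -/
theorem spreadMap_Y (i : Fin n) :
    spreadMap x d (MvPolynomial.X (Sum.inr i)) = MvPolynomial.C (cexp (x i)) := by
  simp [spreadMap]

end Spread

/-! ### Shifted variables plus algebraically independent constants stay algebraically independent -/

/-- In `ℂ[T₁,…,T_r]`, the family consisting of the shifted variables `C a_k + T_k` and the constants
`C (g j)` for a ℚ-algebraically independent family `g` of complex numbers is ℚ-algebraically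
independent. [folklore] -/
theorem algebraicIndependent_shift_constants {r : ℕ} {ι : Type*} (a : Fin r → ℂ) {g : ι → ℂ}
    (hg : AlgebraicIndependent ℚ g) :
    AlgebraicIndependent ℚ
      (Sum.elim (fun k => MvPolynomial.C (a k) + MvPolynomial.X k) (fun j => MvPolynomial.C (g j)) :
        Fin r ⊕ ι → MvPolynomial (Fin r) ℂ) := by
  classical
  set Φ : Fin r ⊕ ι → MvPolynomial (Fin r) ℂ :=
    Sum.elim (fun k => MvPolynomial.C (a k) + MvPolynomial.X k) (fun j => MvPolynomial.C (g j)) with hΦ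
  set Φ' : Fin r ⊕ ι → MvPolynomial (Fin r) ℂ :=
    Sum.elim (fun k => MvPolynomial.X k) (fun j => MvPolynomial.C (g j)) with hΦ'
  rw [algebraicIndependent_iff]
  intro G hG
  -- shift the variables back: `τ (T_k) = T_k − a_k`
  set τ : MvPolynomial (Fin r) ℂ →ₐ[ℂ] MvPolynomial (Fin r) ℂ :=
    MvPolynomial.aeval (fun k => MvPolynomial.X k - MvPolynomial.C (a k)) with hτ
  have hτΦ : ∀ G' : MvPolynomial (Fin r ⊕ ι) ℚ,
      (τ.restrictScalars ℚ) (MvPolynomial.aeval Φ G') = MvPolynomial.aeval Φ' G' := by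
    intro G'
    have hcomp := MvPolynomial.comp_aeval Φ (τ.restrictScalars ℚ)
    rw [← AlgHom.comp_apply, hcomp]
    have hfun : (fun i => (τ.restrictScalars ℚ) (Φ i)) = Φ' := by
      funext i
      rcases i with k | j
      · simp [hΦ, hΦ', hτ]
      · simp [hΦ, hΦ', hτ]
    rw [hfun]
  have h0 : MvPolynomial.aeval Φ' G = 0 := by rw [← hτΦ, hG, map_zero]
  -- `aeval Φ'` = (map the coefficients by `aeval g`) ∘ (separate the variables)
  set agg : MvPolynomial ι ℚ →+* ℂ := (MvPolynomial.aeval g : MvPolynomial ι ℚ →ₐ[ℚ] ℂ).toRingHom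
    with hagg
  have hkey : (MvPolynomial.aeval Φ' : MvPolynomial (Fin r ⊕ ι) ℚ →ₐ[ℚ] MvPolynomial (Fin r) ℂ).toRingHom =
      (MvPolynomial.map agg).comp (MvPolynomial.sumRingEquiv ℚ (Fin r) ι).toRingHom := by
    refine MvPolynomial.ringHom_ext (fun q => ?_) (fun i => ?_)
    · simp [hagg, MvPolynomial.sumRingEquiv_C]
    · rcases i with k | j
      · simp [hagg, hΦ', MvPolynomial.sumRingEquiv_X_inl]
      · simp [hagg, hΦ', MvPolynomial.sumRingEquiv_X_inr]
  have h1 : MvPolynomial.map agg (MvPolynomial.sumRingEquiv ℚ (Fin r) ι G) = 0 := by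
    have h := RingHom.congr_fun hkey G
    simp only [RingHom.coe_comp, Function.comp_apply, RingEquiv.toRingHom_eq_coe,
      RingEquiv.coe_toRingHom] at h
    rw [← h]
    exact h0
  have hinj : Function.Injective agg := algebraicIndependent_iff_injective_aeval.1 hg
  have h2 : MvPolynomial.sumRingEquiv ℚ (Fin r) ι G = 0 :=
    MvPolynomial.map_injective agg hinj (by rw [h1, map_zero])
  exact (MvPolynomial.sumRingEquiv ℚ (Fin r) ι).injective (by rw [h2, map_zero])

/-- `e^{a} ∈ ℚ(e^{x₁},…,e^{xₙ})` for `a` in the `ℤ`-span of `x`. [folklore] -/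
theorem exp_mem_adjoin_exp_of_mem_span_int {ι : Type*} (x : ι → ℂ) {a : ℂ}
    (ha : a ∈ Submodule.span ℤ (Set.range x)) :
    cexp a ∈ IntermediateField.adjoin ℚ (Set.range (cexp ∘ x)) := by
  set K := IntermediateField.adjoin ℚ (Set.range (cexp ∘ x))
  induction ha using Submodule.span_induction with
  | mem b hb =>
    obtain ⟨i, rfl⟩ := hb
    exact IntermediateField.subset_adjoin ℚ _ ⟨i, rfl⟩
  | zero => rw [Complex.exp_zero]; exact one_mem K
  | add b c _ _ hb hc => rw [Complex.exp_add]; exact mul_mem hb hc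
  | smul m b _ hb =>
    rw [zsmul_eq_mul, Complex.exp_int_mul]
    exact zpow_mem hb m

/-- Independent rational forms of an independent tuple form an independent tuple. [folklore] -/
theorem linearIndependent_forms {n m : ℕ} {x : Fin n → ℂ} (hx : LinearIndependent ℚ x)
    {q : Fin m → Fin n → ℚ} (hq : LinearIndependent ℚ q) :
    LinearIndependent ℚ (fun j => ∑ i, ((q j i : ℚ) : ℂ) * x i) := by
  rw [Fintype.linearIndependent_iff]
  intro s hs
  -- `Σ_j s_j (Σ_i q_ji x_i) = Σ_i (Σ_j s_j q_ji) x_i = 0`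
  have h1 : ∑ i, ((∑ j, s j * q j i : ℚ) : ℂ) * x i = 0 := by
    rw [← hs]
    simp only [Rat.cast_sum, Rat.cast_mul, Finset.sum_mul, Rat.smul_def, Finset.mul_sum]
    rw [Finset.sum_comm]
    refine Finset.sum_congr rfl fun j _ => Finset.sum_congr rfl fun i _ => ?_
    ring
  have h2 : ∀ i, ∑ j, s j * q j i = 0 := by
    have h := (Fintype.linearIndependent_iff.1 hx) (fun i => ∑ j, s j * q j i) (by
      rw [← h1]
      refine Finset.sum_congr rfl fun i _ => ?_
      rw [Rat.smul_def])
    exact h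
  have h3 : ∑ j, s j • q j = 0 := by
    funext i
    simp only [Finset.sum_apply, Pi.smul_apply, smul_eq_mul, Pi.zero_apply]
    exact h2 i
  exact (Fintype.linearIndependent_iff.1 hq) s h3

/-! ### The endgame: a rational affine subspace inside the frozen fibre is a smaller counterexample -/

/-- **`stub_endgame` of the PICKED line `kernel-arithmetic-selection`, VERBATIM, proved.**  If `x` is a
first failure of rank `n`, `m < n`, `q` are `m` independent rational forms and the affine space
`{z | q z = q x}` lies in the frozen fibre `{z | ∀ p ∈ rel x, p(z, eˣ) = 0}`, then `False`: spreading
the fibre along a kernel frame (`spreadMap`) realises `ℚ[x, eˣ]` inside `ℂ[T₁..T_r]` (`r = n − m`)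
with `r` shifted variables `c_k·x + T_k` and `m` algebraically independent constants among
`q x ∪ eˣ` (from `SchanuelRank m` applied to `y = q x`, whose exponentials are algebraic over `ℚ(eˣ)`);
pulling back gives `n = r + m` algebraically independent elements of `ℚ(x, eˣ)`, against `trdeg < n`.
[cite: Kirby2010, §1] -/
theorem stub_endgame_holds : ∀ (n : ℕ) (x : Fin n → ℂ), (LinearIndependent ℚ x ∧ Algebra.trdeg ℚ ↥(IntermediateField.adjoin ℚ (Set.range x ∪ Set.range (Complex.exp ∘ x))) < (n : Cardinal) ∧ ∀ r < n, Literature.NumberTheory.Transcendental.SchanuelRank r) → ∀ (m : ℕ), m < n → ∀ (q : Fin m → Fin n → ℚ), LinearIndependent ℚ q → (∀ z : Fin n → ℂ, (∀ j, ∑ i, (q j i : ℂ) * z i = ∑ i, (q j i : ℂ) * x i) → ∀ p : MvPolynomial (Fin n ⊕ Fin n) ℚ, MvPolynomial.aeval (Sum.elim x (Complex.exp ∘ x)) p = 0 → MvPolynomial.aeval (Sum.elim z (Complex.exp ∘ x)) p = 0) → False := by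
  intro n x hx m hm q hq H
  classical
  obtain ⟨r, d, c, hrm, hqd, hcd⟩ := exists_kernel_frame q hq
  set v : Fin n ⊕ Fin n → ℂ := Sum.elim x (cexp ∘ x) with hv
  -- (A) every relation of `(x, eˣ)` dies under the spreading map
  have hψ : ∀ p : MvPolynomial (Fin n ⊕ Fin n) ℚ, MvPolynomial.aeval v p = 0 → spreadMap x d p = 0 := by
    intro p hp
    apply MvPolynomial.funext
    intro t
    rw [eval_spreadMap, map_zero]
    refine H _ (fun j => ?_) p hp
    simp only [mul_add, Finset.sum_add_distrib, Finset.mul_sum]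
    have hzero : ∑ i, ∑ k, ((q j i : ℚ) : ℂ) * ((((d k i : ℚ)) : ℂ) * t k) = 0 := by
      rw [Finset.sum_comm]
      refine Finset.sum_eq_zero fun k _ => ?_
      have h' : ∑ i, ((q j i : ℚ) : ℂ) * ((d k i : ℚ) : ℂ) = 0 := by
        have h := hqd j k
        have : ((∑ i, q j i * d k i : ℚ) : ℂ) = 0 := by rw [h, Rat.cast_zero]
        simpa [Rat.cast_sum, Rat.cast_mul] using this
      calc ∑ i, ((q j i : ℚ) : ℂ) * ((((d k i : ℚ)) : ℂ) * t k)
          = (∑ i, ((q j i : ℚ) : ℂ) * ((d k i : ℚ) : ℂ)) * t k := by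
            rw [Finset.sum_mul]
            refine Finset.sum_congr rfl fun i _ => ?_
            ring
        _ = 0 := by rw [h', zero_mul]
    rw [hzero, add_zero]
  -- (B) `y = q x`, the generators `g = (y, eˣ)`, and `m` independent elements among them
  set y : Fin m → ℂ := fun j => ∑ i, ((q j i : ℚ) : ℂ) * x i with hy
  have hyli : LinearIndependent ℚ y := linearIndependent_forms hx.1 hq
  set g : Fin m ⊕ Fin n → ℂ := Sum.elim y (cexp ∘ x) with hg
  have hy_span : ∀ j, y j ∈ Submodule.span ℚ (Set.range x) := fun j =>
    Submodule.sum_mem _ fun i _ => by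
      rw [show ((q j i : ℚ) : ℂ) * x i = (q j i : ℚ) • x i by rw [Rat.smul_def]]
      exact Submodule.smul_mem _ _ (Submodule.subset_span ⟨i, rfl⟩)
  have hsub : Set.range y ∪ Set.range (cexp ∘ y) ⊆ GammaField.acl (Set.range g) := by
    rintro w (⟨j, rfl⟩ | ⟨j, rfl⟩)
    · exact GammaField.subset_acl _ ⟨Sum.inl j, rfl⟩
    · -- `(e^{y_j})^N ∈ ℚ(eˣ) ⊆ ℚ(g) ⊆ acl (range g)`
      obtain ⟨N, hN, hNmem⟩ := exists_nsmul_mem_span_int x (hy_span j)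
      have hpow : cexp (y j) ^ N ∈ GammaField.acl (Set.range g) := by
        have h1 : cexp ((N : ℚ) • y j) = cexp (y j) ^ N := by
          rw [show ((N : ℚ) • y j : ℂ) = (N : ℂ) * y j by rw [Rat.smul_def]; push_cast; ring]
          exact Complex.exp_nat_mul (y j) N
        rw [← h1]
        refine GammaField.adjoin_subset_acl (Set.range g) ?_
        have hle : IntermediateField.adjoin ℚ (Set.range (cexp ∘ x)) ≤
            IntermediateField.adjoin ℚ (Set.range g) :=
          IntermediateField.adjoin.mono ℚ _ _ (by rintro a ⟨i, rfl⟩; exact ⟨Sum.inr i, rfl⟩)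
        exact hle (exp_mem_adjoin_exp_of_mem_span_int x hNmem)
      simpa using GammaField.mem_acl_of_pow_mem hN hpow
  have hm_le : (m : ℕ∞) ≤ (GammaField.algMatroid ℂ).eRk (Set.range g) := by
    have h1 : (m : Cardinal) ≤
        Algebra.trdeg ℚ ↥(IntermediateField.adjoin ℚ (Set.range y ∪ Set.range (cexp ∘ y))) :=
      hx.2.2 m hm y hyli
    refine (ZilberHomogeneity.natCast_le_eRk_of_le_trdeg h1).trans ?_
    calc (GammaField.algMatroid ℂ).eRk (Set.range y ∪ Set.range (cexp ∘ y))
        ≤ (GammaField.algMatroid ℂ).eRk ((GammaField.algMatroid ℂ).closure (Set.range g)) :=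
          (GammaField.algMatroid ℂ).eRk_mono hsub
      _ = (GammaField.algMatroid ℂ).eRk (Set.range g) := (GammaField.algMatroid ℂ).eRk_closure_eq _
  obtain ⟨J, hJsub, hJind, hJcard⟩ := Matroid.le_eRk_iff.1 hm_le
  have hpre : ∀ j : J, ∃ s : Fin m ⊕ Fin n, g s = (j : ℂ) := fun j => hJsub j.2
  choose f hf using hpre
  have hgf : AlgebraicIndependent ℚ (g ∘ f) := by
    have hfun : g ∘ f = (Subtype.val : J → ℂ) := funext hf
    rw [hfun]
    exact AlgebraicIndependent.matroid_indep_iff.1 hJind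
  -- (C) the two families of polynomials and their images
  set a : Fin r → ℂ := fun k => ∑ i, ((c k i : ℚ) : ℂ) * x i with ha
  set P : Fin r ⊕ J → MvPolynomial (Fin n ⊕ Fin n) ℚ :=
    Sum.elim (fun k => ∑ i, MvPolynomial.C (c k i) * MvPolynomial.X (Sum.inl i))
      (fun j => Sum.elim (fun j' => ∑ i, MvPolynomial.C (q j' i) * MvPolynomial.X (Sum.inl i))
        (fun i => MvPolynomial.X (Sum.inr i)) (f j)) with hP
  set Φ : Fin r ⊕ J → MvPolynomial (Fin r) ℂ :=
    Sum.elim (fun k => MvPolynomial.C (a k) + MvPolynomial.X k) (fun j => MvPolynomial.C (g (f j))) with hΦ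
  have hψP : ∀ ℓ, spreadMap x d (P ℓ) = Φ ℓ := by
    rintro (k | j)
    · simp only [hP, hΦ, Sum.elim_inl]
      rw [spreadMap_linearForm]
      congr 1
      rw [Finset.sum_eq_single k]
      · simp [hcd]
      · intro k' _ hk'
        simp [hcd, Ne.symm hk']
      · intro h; exact absurd (Finset.mem_univ k) h
    · simp only [hP, hΦ, Sum.elim_inr]
      rcases hfj : f j with j' | i
      · simp only [Sum.elim_inl]
        rw [spreadMap_linearForm]
        simp [hqd, hg, hy]
      · simp only [Sum.elim_inr]
        rw [spreadMap_Y]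
        simp [hg]
  have hvP : ∀ ℓ, MvPolynomial.aeval v (P ℓ) = Sum.elim a (fun j : J => (j : ℂ)) ℓ := by
    rintro (k | j)
    · simp [hP, hv, ha]
    · simp only [hP, Sum.elim_inr]
      rw [← hf j]
      rcases hfj : f j with j' | i
      · simp [hv, hg, hy]
      · simp [hv, hg]
  -- (D) independence transfers back to `ℚ(x, eˣ)`
  have hΦind : AlgebraicIndependent ℚ Φ := algebraicIndependent_shift_constants a hgf
  have hα : AlgebraicIndependent ℚ (Sum.elim a (fun j : J => (j : ℂ))) := by
    rw [algebraicIndependent_iff]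
    intro G hG
    apply algebraicIndependent_iff.1 hΦind
    have h1 : MvPolynomial.aeval v (MvPolynomial.aeval P G) = 0 := by
      rw [← AlgHom.comp_apply, MvPolynomial.comp_aeval]
      have hfun : (fun ℓ => MvPolynomial.aeval v (P ℓ)) = Sum.elim a (fun j : J => (j : ℂ)) := funext hvP
      rw [hfun]
      exact hG
    have h2 := hψ _ h1
    rw [← AlgHom.comp_apply, MvPolynomial.comp_aeval] at h2
    have hfun : (fun ℓ => spreadMap x d (P ℓ)) = Φ := funext hψP
    rw [hfun] at h2
    exact h2
  -- (E) count: `n = r + m` independent elements inside `ℚ(x, eˣ)` of `trdeg < n`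
  set K := IntermediateField.adjoin ℚ (Set.range x ∪ Set.range (cexp ∘ x)) with hK
  have hxK : ∀ i, x i ∈ K := fun i => IntermediateField.subset_adjoin ℚ _ (Or.inl ⟨i, rfl⟩)
  have heK : ∀ i, cexp (x i) ∈ K := fun i => IntermediateField.subset_adjoin ℚ _ (Or.inr ⟨i, rfl⟩)
  have hmem : ∀ ℓ, Sum.elim a (fun j : J => (j : ℂ)) ℓ ∈ K := by
    rintro (k | j)
    · simp only [Sum.elim_inl, ha]
      exact sum_mem fun i _ => mul_mem (by exact_mod_cast (algebraMap ℚ K (c k i)).2) (hxK i)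
    · simp only [Sum.elim_inr]
      rw [← hf j]
      rcases f j with j' | i
      · simp only [hg, Sum.elim_inl, hy]
        exact sum_mem fun i _ => mul_mem (by exact_mod_cast (algebraMap ℚ K (q j' i)).2) (hxK i)
      · exact heK i
  let w : Fin r ⊕ J → K := fun ℓ => ⟨_, hmem ℓ⟩
  have hw : AlgebraicIndependent ℚ w := AlgebraicIndependent.of_comp K.val hα
  have hle := hw.cardinalMk_le_trdeg
  have hfin : (J : Set ℂ).Finite := Set.finite_of_encard_eq_coe hJcard
  haveI : Fintype J := hfin.fintype
  have hcardJ : Fintype.card J = m := by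
    have h := hJcard
    rw [Set.encard_eq_coe_toFinset_card, Set.toFinset_card] at h
    exact_mod_cast h
  have hcard : Cardinal.mk (Fin r ⊕ J) = (n : Cardinal) := by
    rw [Cardinal.mk_fintype, Fintype.card_sum, Fintype.card_fin, hcardJ, hrm]
  rw [hcard] at hle
  exact (not_le.2 hx.2.1) hle

end Summit.Schanuel.Schanuel.Cruxes.MinimalCounterexampleInAcl.StubsEvidence6

end
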